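import Summits.ValiantsHypothesis.ValiantsHypothesis.Theorems.GrenetZeonDualUnipotentThreeHalvesHeavyTopInstFourSevenDefs
import Summits.ValiantsHypothesis.ValiantsHypothesis.Theorems.GrenetZeonDualUnipotentThreeHalvesHeavyTopInstFourSevenToolkit

/-!
# `GrenetZeon.DualUnipotentThreeHalves` (stmt-ValiantsHypothesis-24318) — successor line `slow_core`, the format `(4,7)` in POWER currency:
# helper C — the far-corner pencil `NSeven` ALONG A LINE: the cube `(Q(x) + s·Q(v))³`, its `s`-coefficients, and what they force

Experiment cell «val-heavytop-census» (D-0160), engine seat val-htc-eng-1 g2 (kernel-only lane, director-valiant g17 R315 (4)).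
Part of the chain `…SlowFourSeven{Square, Cube, Line}` → `…/Negative/SlowFourSeven` (`¬ Slow 4 7 NSeven`).

`Slow 4 7 NSeven` (✓ `…SlowCoreDefs`) bounds the `s`-degree of the entries of `N(x + s v)³ = (Q(x) + s·Q(v))³` (`Q = topSeven`,
✓ `…HeavyTopInstFourSevenDefs`).  Here: the pencil along a line (`NSeven_map_lineSubst`), the entrywise expansion of the cube with
coefficients `c₁ = Q(x)²Q(v) + Q(x)Q(v)Q(x) + Q(v)Q(x)²`, `c₂ = Q(x)Q(v)² + Q(v)Q(x)Q(v) + Q(v)²Q(x)`, `c₃ = Q(v)³` (`cube_apply`,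
`coeff_cube_one/two/three`, degree lower bounds), the nine coordinate tops not already in ✓ `…HeavyTopInstFourSevenBlocks` as matrix units (`top_single_pq`; the other seven are ✓ `topSeven_single_10/11/20/21/30/31/13` there), and the two
elementary extractions the verdict uses:
* `key_two` — if `c₂` vanishes for the matrix unit `E_{ab}` then `Q(v)·E_{ab}·Q(v) = 0`, row `b` and column `a` of `Q(v)²` vanish
  off the diagonal (power budget `1` ⇒ the inputs of ✓ `no_squareCorner_NSeven`);
* `key_one` — if the POLARISED `c₁` vanishes for the path `E_{ab}, E_{bd}` then row `d` and column `a` of `Q(v)` vanish off the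
  diagonal (power budget `0` ⇒ `v = 0`).

Honest framing: bookkeeping for ONE tiny format in the successor currency (`--supports stmt-ValiantsHypothesis-24318 --as helper`);
nothing here asserts or refutes R2ᵖ `HeavyTopSlowLaw`, S3, IRR/RED, the crux, 8062 or `VP ≠ VNP` — all OPEN / NOT proved.
No definitions, no named facts. [✓ `…HeavyTopInstFourSevenDefs/Toolkit` (val-port-2 g2); ✓ `…/Negative/SlowThreeFive` (this seat, the `(3,5)` twin)]
-/

set_option linter.dupNamespace false
set_option autoImplicit false

noncomputable section

namespace Summit.ValiantsHypothesis.ValiantsHypothesis.Theorems.GrenetZeon.SlowFourSeven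

open MvPolynomial Matrix
open scoped BigOperators
open Summit.ValiantsHypothesis.ValiantsHypothesis.Theorems.GrenetZeon.RadicalSplit

/-! ## §1 The pencil along a line and the entries of its cube -/

/-- Along the line `x + s·v` the pencil `NSeven` is `Q(x) + s·Q(v)` (`Q = topSeven`, `s = X 0`). -/
theorem NSeven_map_lineSubst (x v : Fin 4 × Fin 4 → ℂ) :
    NSeven.map (lineSubst x v) =
      (topSeven x).map C + (X 0 : MvPolynomial (Fin 1) ℂ) • (topSeven v).map C := by
  ext i j
  fin_cases i <;> fin_cases j <;> simp [NSeven, topSeven, lineSubst, Matrix.map_apply, mul_comm]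

set_option maxHeartbeats 1600000 in
/-- An entry of the cube along a line: `c₀ + c₁·s + c₂·s² + c₃·s³` with the non-commutative coefficients displayed. -/
theorem cube_apply (x v : Fin 4 × Fin 4 → ℂ) (i j : Fin 7) :
    ((NSeven.map (lineSubst x v)) ^ 3) i j =
      C ((topSeven x * topSeven x * topSeven x) i j)
      + C ((topSeven x * topSeven x * topSeven v + topSeven x * topSeven v * topSeven x
            + topSeven v * topSeven x * topSeven x) i j) * X 0 ^ 1
      + C ((topSeven x * topSeven v * topSeven v + topSeven v * topSeven x * topSeven v
            + topSeven v * topSeven v * topSeven x) i j) * X 0 ^ 2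
      + C ((topSeven v * topSeven v * topSeven v) i j) * X 0 ^ 3 := by
  rw [NSeven_map_lineSubst, pow_succ, pow_two, Matrix.mul_apply]
  simp only [Matrix.mul_apply, Matrix.add_apply, Matrix.smul_apply, Matrix.map_apply, smul_eq_mul, Fin.sum_univ_seven,
    map_add, map_mul, add_mul]
  ring

/-- The `s³`-coefficient of an entry of the cube is the entry of `Q(v)³`. -/
theorem coeff_cube_three (x v : Fin 4 × Fin 4 → ℂ) (i j : Fin 7) :
    coeff (Finsupp.single 0 3) (((NSeven.map (lineSubst x v)) ^ 3) i j) = (topSeven v * topSeven v * topSeven v) i j := by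
  rw [cube_apply]
  have h1 : (Finsupp.single (0 : Fin 1) 1 : Fin 1 →₀ ℕ) ≠ Finsupp.single 0 3 := by
    rw [Ne, Finsupp.single_eq_single_iff]; omega
  have h2 : (Finsupp.single (0 : Fin 1) 2 : Fin 1 →₀ ℕ) ≠ Finsupp.single 0 3 := by
    rw [Ne, Finsupp.single_eq_single_iff]; omega
  have h0 : (0 : Fin 1 →₀ ℕ) ≠ Finsupp.single 0 3 := by
    rw [Ne, eq_comm, Finsupp.single_eq_zero]; omega
  simp only [coeff_add, coeff_C_mul, coeff_C, coeff_X_pow, h1, h2, h0, if_true, if_false, mul_one, mul_zero, add_zero,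
    zero_add]

/-- The `s²`-coefficient of an entry of the cube is the entry of `Q(x)Q(v)² + Q(v)Q(x)Q(v) + Q(v)²Q(x)`. -/
theorem coeff_cube_two (x v : Fin 4 × Fin 4 → ℂ) (i j : Fin 7) :
    coeff (Finsupp.single 0 2) (((NSeven.map (lineSubst x v)) ^ 3) i j) =
      (topSeven x * topSeven v * topSeven v + topSeven v * topSeven x * topSeven v
        + topSeven v * topSeven v * topSeven x) i j := by
  rw [cube_apply]
  have h1 : (Finsupp.single (0 : Fin 1) 1 : Fin 1 →₀ ℕ) ≠ Finsupp.single 0 2 := by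
    rw [Ne, Finsupp.single_eq_single_iff]; omega
  have h3 : (Finsupp.single (0 : Fin 1) 3 : Fin 1 →₀ ℕ) ≠ Finsupp.single 0 2 := by
    rw [Ne, Finsupp.single_eq_single_iff]; omega
  have h0 : (0 : Fin 1 →₀ ℕ) ≠ Finsupp.single 0 2 := by
    rw [Ne, eq_comm, Finsupp.single_eq_zero]; omega
  simp only [coeff_add, coeff_C_mul, coeff_C, coeff_X_pow, h1, h3, h0, if_true, if_false, mul_one, mul_zero, add_zero,
    zero_add]

/-- The `s`-coefficient of an entry of the cube is the entry of `Q(x)²Q(v) + Q(x)Q(v)Q(x) + Q(v)Q(x)²`. -/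
theorem coeff_cube_one (x v : Fin 4 × Fin 4 → ℂ) (i j : Fin 7) :
    coeff (Finsupp.single 0 1) (((NSeven.map (lineSubst x v)) ^ 3) i j) =
      (topSeven x * topSeven x * topSeven v + topSeven x * topSeven v * topSeven x
        + topSeven v * topSeven x * topSeven x) i j := by
  rw [cube_apply]
  have h2 : (Finsupp.single (0 : Fin 1) 2 : Fin 1 →₀ ℕ) ≠ Finsupp.single 0 1 := by
    rw [Ne, Finsupp.single_eq_single_iff]; omega
  have h3 : (Finsupp.single (0 : Fin 1) 3 : Fin 1 →₀ ℕ) ≠ Finsupp.single 0 1 := by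
    rw [Ne, Finsupp.single_eq_single_iff]; omega
  have h0 : (0 : Fin 1 →₀ ℕ) ≠ Finsupp.single 0 1 := by
    rw [Ne, eq_comm, Finsupp.single_eq_zero]; omega
  simp only [coeff_add, coeff_C_mul, coeff_C, coeff_X_pow, h2, h3, h0, if_true, if_false, mul_one, mul_zero, add_zero,
    zero_add]

/-- A non-zero `s^e`-coefficient forces `s`-degree `≥ e`. -/
theorem le_totalDegree_of_coeff_ne_zero {p : MvPolynomial (Fin 1) ℂ} {e : ℕ} (h : coeff (Finsupp.single 0 e) p ≠ 0) :
    e ≤ p.totalDegree := by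
  have hs : (Finsupp.single (0 : Fin 1) e : Fin 1 →₀ ℕ) ∈ p.support := by rwa [mem_support_iff]
  simpa using le_totalDegree hs

/-! ## §2 The top space: matrix units, additivity, the zero triangle -/

/-- `topSeven` is additive. -/
theorem topSeven_add (x y : Fin 4 × Fin 4 → ℂ) : topSeven (x + y) = topSeven x + topSeven y := by
  ext i j; fin_cases i <;> fin_cases j <;> simp [topSeven]

/-- Tops are strictly upper triangular: `Q(v)_{ij} = 0` for `j ≤ i`. -/
theorem topSeven_apply_of_le (v : Fin 4 × Fin 4 → ℂ) (i j : Fin 7) (h : (j : ℕ) ≤ i) : topSeven v i j = 0 := by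
  fin_cases i <;> fin_cases j <;> simp [topSeven] <;> simp at h

/-- The coordinate top `e_(0,0)` is the matrix unit `E_{01}` (0-based). -/
theorem top_single_00 : topSeven (Pi.single ((0 : Fin 4), (0 : Fin 4)) (1 : ℂ)) = Matrix.single (0 : Fin 7) (1 : Fin 7) (1 : ℂ) := by
  ext i j; fin_cases i <;> fin_cases j <;> simp [topSeven, Matrix.single]

/-- The coordinate top `e_(0,1)` is the matrix unit `E_{02}` (0-based). -/
theorem top_single_01 : topSeven (Pi.single ((0 : Fin 4), (1 : Fin 4)) (1 : ℂ)) = Matrix.single (0 : Fin 7) (2 : Fin 7) (1 : ℂ) := by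
  ext i j; fin_cases i <;> fin_cases j <;> simp [topSeven, Matrix.single]

/-- The coordinate top `e_(0,2)` is the matrix unit `E_{03}` (0-based). -/
theorem top_single_02 : topSeven (Pi.single ((0 : Fin 4), (2 : Fin 4)) (1 : ℂ)) = Matrix.single (0 : Fin 7) (3 : Fin 7) (1 : ℂ) := by
  ext i j; fin_cases i <;> fin_cases j <;> simp [topSeven, Matrix.single]

/-- The coordinate top `e_(0,3)` is the matrix unit `E_{04}` (0-based). -/
theorem top_single_03 : topSeven (Pi.single ((0 : Fin 4), (3 : Fin 4)) (1 : ℂ)) = Matrix.single (0 : Fin 7) (4 : Fin 7) (1 : ℂ) := by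
  ext i j; fin_cases i <;> fin_cases j <;> simp [topSeven, Matrix.single]

/-- The coordinate top `e_(1,2)` is the matrix unit `E_{14}` (0-based). -/
theorem top_single_12 : topSeven (Pi.single ((1 : Fin 4), (2 : Fin 4)) (1 : ℂ)) = Matrix.single (1 : Fin 7) (4 : Fin 7) (1 : ℂ) := by
  ext i j; fin_cases i <;> fin_cases j <;> simp [topSeven, Matrix.single]

/-- The coordinate top `e_(2,2)` is the matrix unit `E_{25}` (0-based). -/
theorem top_single_22 : topSeven (Pi.single ((2 : Fin 4), (2 : Fin 4)) (1 : ℂ)) = Matrix.single (2 : Fin 7) (5 : Fin 7) (1 : ℂ) := by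
  ext i j; fin_cases i <;> fin_cases j <;> simp [topSeven, Matrix.single]

/-- The coordinate top `e_(2,3)` is the matrix unit `E_{46}` (0-based). -/
theorem top_single_23 : topSeven (Pi.single ((2 : Fin 4), (3 : Fin 4)) (1 : ℂ)) = Matrix.single (4 : Fin 7) (6 : Fin 7) (1 : ℂ) := by
  ext i j; fin_cases i <;> fin_cases j <;> simp [topSeven, Matrix.single]

/-- The coordinate top `e_(3,2)` is the matrix unit `E_{36}` (0-based). -/
theorem top_single_32 : topSeven (Pi.single ((3 : Fin 4), (2 : Fin 4)) (1 : ℂ)) = Matrix.single (3 : Fin 7) (6 : Fin 7) (1 : ℂ) := by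
  ext i j; fin_cases i <;> fin_cases j <;> simp [topSeven, Matrix.single]

/-- The coordinate top `e_(3,3)` is the matrix unit `E_{56}` (0-based). -/
theorem top_single_33 : topSeven (Pi.single ((3 : Fin 4), (3 : Fin 4)) (1 : ℂ)) = Matrix.single (5 : Fin 7) (6 : Fin 7) (1 : ℂ) := by
  ext i j; fin_cases i <;> fin_cases j <;> simp [topSeven, Matrix.single]

/-! ## §3 The two extractions -/

/-- **Budget one, per matrix unit.**  If the `s²`-coefficient `E·B² + B·E·B + B²·E` vanishes for the unit `E = E_{ab}` and `B` has zero
diagonal, then `B·E_{ab}·B = 0`, and row `b` / column `a` of `B²` vanish off the diagonal. -/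
theorem key_two (B : Matrix (Fin 7) (Fin 7) ℂ) (hdiag : ∀ i, B i i = 0) (a b : Fin 7)
    (h : ∀ i j, ((Matrix.single a b (1 : ℂ) * B * B + B * Matrix.single a b 1 * B + B * B * Matrix.single a b 1 :
      Matrix (Fin 7) (Fin 7) ℂ)) i j = 0) :
    B * Matrix.single a b 1 * B = 0 ∧ (∀ j, j ≠ b → (B * B) b j = 0) ∧ (∀ i, i ≠ a → (B * B) i a = 0) := by
  have e : ∀ i j, ((Matrix.single a b (1 : ℂ) * B * B + B * Matrix.single a b 1 * B + B * B * Matrix.single a b 1 :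
      Matrix (Fin 7) (Fin 7) ℂ)) i j =
      (if i = a then (B * B) b j else 0) + B i a * B b j + (if j = b then (B * B) i a else 0) := by
    intro i j
    rw [Matrix.add_apply, Matrix.add_apply, mul_single_mul_apply, Matrix.mul_assoc (Matrix.single a b (1 : ℂ))]
    congr 1
    · congr 1
      by_cases hi : i = a
      · subst hi; simp
      · simp [hi]
    · by_cases hj : j = b
      · subst hj; simp
      · simp [hj]
  have hrow : ∀ j, j ≠ b → (B * B) b j = 0 := fun j hj => by
    have h1 := h a j; rw [e, if_pos rfl, if_neg hj, hdiag a] at h1; simpa using h1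
  have hcol : ∀ i, i ≠ a → (B * B) i a = 0 := fun i hi => by
    have h1 := h i b; rw [e, if_neg hi, if_pos rfl, hdiag b] at h1; simpa using h1
  refine ⟨?_, hrow, hcol⟩
  ext i j
  rw [mul_single_mul_apply, Matrix.zero_apply]
  by_cases hi : i = a
  · subst hi; rw [hdiag i, zero_mul]
  by_cases hj : j = b
  · subst hj; rw [hdiag j, mul_zero]
  have h1 := h i j
  rw [e, if_neg hi, if_neg hj] at h1
  simpa using h1

/-- **Budget zero, per path of matrix units.**  If the polarised `s`-coefficient vanishes for the path `E_{ab}, E_{bd}` (`a < d`) and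
`B` is strictly upper triangular, then row `d` and column `a` of `B` vanish off the diagonal. -/
theorem key_one (B : Matrix (Fin 7) (Fin 7) ℂ) (hlow : ∀ i j : Fin 7, (j : ℕ) ≤ i → B i j = 0) (a b d : Fin 7) (had : a < d)
    (h : ∀ i j, ((Matrix.single a d (1 : ℂ) * B + Matrix.single a b 1 * B * Matrix.single b d 1
      + Matrix.single b d 1 * B * Matrix.single a b 1 + B * Matrix.single a d 1 : Matrix (Fin 7) (Fin 7) ℂ)) i j = 0) :
    (∀ j, j ≠ d → B d j = 0) ∧ (∀ i, i ≠ a → B i a = 0) := by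
  have hda : B d a = 0 := hlow d a (le_of_lt had)
  have hbb : B b b = 0 := hlow b b le_rfl
  have e : ∀ i j, ((Matrix.single a d (1 : ℂ) * B + Matrix.single a b 1 * B * Matrix.single b d 1
      + Matrix.single b d 1 * B * Matrix.single a b 1 + B * Matrix.single a d 1 : Matrix (Fin 7) (Fin 7) ℂ)) i j =
      (if i = a then B d j else 0) + (if j = d then B i a else 0) := by
    intro i j
    simp only [Matrix.add_apply, Matrix.single_mul_mul_single, hbb, hda, mul_zero, zero_mul, Matrix.single_apply,
      ite_self, add_zero]
    congr 1
    · by_cases hi : i = a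
      · subst hi; simp
      · simp [hi]
    · by_cases hj : j = d
      · subst hj; simp
      · simp [hj]
  refine ⟨fun j hj => ?_, fun i hi => ?_⟩
  · have h1 := h a j; rw [e, if_pos rfl, if_neg hj] at h1; simpa using h1
  · have h1 := h i d; rw [e, if_neg hi, if_pos rfl] at h1; simpa using h1

end Summit.ValiantsHypothesis.ValiantsHypothesis.Theorems.GrenetZeon.SlowFourSeven

end
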